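import Literature.Computability.Complexity.Williams2014Transfer
import Literature.Computability.Complexity.SharpPClosure
import Literature.Computability.Complexity.FoldBricks
import Literature.Computability.Complexity.UnaryBricks
import HarnessLib

/-!
# `FP` bricks around the index width `n + c log₂ n + c` of a succinct reduction

Literature / complexity toolkit (serves the derivation of Williams' Thm. 5.1 from Thm. 5.2,
`Williams2014Transfer.lean`: the clause-checking verifier enumerates the `2 ^ succinctWidth c n`
clauses of the presented formula `succinctCNF c cl x` and compares the length of its witness
with `2 ^ m(n)`, so it needs these quantities as numerals computed in polynomial time from
`x`). Everything is assembled from the tree's bricks, no machine is written: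

* `widthOnesFn c : x ↦ 1^{succinctWidth c |x|}` (`= 1^{|x|} ++ (1^{log₂|x|})ᶜ ++ 1ᶜ`, with the
  tree's `Brick.logFn : x ↦ 1^{log₂ |x|}` of `UnaryBricks.lean` and `onesFn` of
  `PairPlumbing.lean`);
* `powTwoWidthFn c : x ↦ bin 2^{succinctWidth c |x|}`, `powTwoPolyFn Q : x ↦ bin 2^{Q(|x|)}`
  (`TimeConstructible.powFn 1 : 1ᵐ ↦ bin 2ᵐ` of `NSubexp.lean` after the unary words);
each in `FP` with its value lemma (the length in binary, `y ↦ bin |y|`, is the tree's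
`Brick.lenBinF` of `FoldBricks.lean`). (Librarian note: the identity `bin 2ᵐ = 0ᵐ1` has
several copies in the tree — `Com.encodeNat_two_pow`, `TavRecode.encodeNat_two_pow`, inline in
`NSubexp.powFn_unary` —; none is added here.)

## References

* S. Arora, B. Barak, *Computational Complexity: A Modern Approach*, CUP 2009, §1.3 (closure of
  polynomial time under composition; unary/binary conversions).
* R. Williams, *Nonuniform ACC circuit lower bounds*, J. ACM 61 (2014), Fact 3.1 (the
  `n + c log n` input bits of `Cₓ`).
-/

namespace Literature.Computability.Complexity

open _root_.Computability Polynomial Brick Plumb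

/-! ### The unary width -/

/-- `c`-fold concatenation of the output of `f`. [folklore] -/
def repAppendFn (f : List Bool → List Bool) : ℕ → List Bool → List Bool
  | 0 => fun _ => []
  | c + 1 => fun z => f z ++ repAppendFn f c z

/-- Value of `repAppendFn` on a function with replicate values. [folklore] -/
theorem repAppendFn_replicate {f : List Bool → List Bool} {z : List Bool} {m : ℕ}
    (h : f z = List.replicate m true) : ∀ c : ℕ,
    repAppendFn f c z = List.replicate (c * m) true
  | 0 => by simp [repAppendFn]
  | c + 1 => by
    show f z ++ repAppendFn f c z = _
    rw [repAppendFn_replicate h c, h, ← List.replicate_add]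
    congr 1
    ring

/-- `repAppendFn f c ∈ FP` for `f ∈ FP`. [folklore] -/
theorem repAppendFn_mem_FP {f : List Bool → List Bool} (hf : f ∈ FP) : ∀ c : ℕ,
    repAppendFn f c ∈ FP
  | 0 => const_mem_FP _
  | c + 1 => append_mem_FP hf (repAppendFn_mem_FP hf c)

/-- **The unary width** `widthOnesFn c x = 1^{succinctWidth c |x|}`
(`succinctWidth c n = n + c log₂ n + c`). [folklore] -/
noncomputable def widthOnesFn (c : ℕ) : List Bool → List Bool :=
  fun x => onesFn x ++ (repAppendFn logFn c x ++ List.replicate c true)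

/-- Value of `widthOnesFn`. [folklore] -/
@[simp] theorem widthOnesFn_apply (c : ℕ) (x : List Bool) :
    widthOnesFn c x = List.replicate (succinctWidth c x.length) true := by
  rw [widthOnesFn, onesFn_eq_replicate,
    repAppendFn_replicate (m := Nat.log 2 x.length) (by simp [logFn, ones]) c,
    ← List.replicate_add, ← List.replicate_add, succinctWidth, Nat.add_assoc]

/-- `widthOnesFn c ∈ FP`. [folklore] -/
theorem widthOnesFn_mem_FP (c : ℕ) : widthOnesFn c ∈ FP :=
  append_mem_FP onesFn_mem_FP (append_mem_FP (repAppendFn_mem_FP logFn_mem_FP c) (const_mem_FP _))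

/-! ### Powers of two in binary -/

/-- `TimeConstructible.powFn 1` on a unary word: `1ᵐ ↦ bin 2ᵐ`. [folklore] -/
theorem powFn_one_replicate (m : ℕ) :
    TimeConstructible.powFn 1 (List.replicate m true) = encodeNat (2 ^ m) := by
  rw [← OracleCompose.unaryEncodeNat_eq_replicate, TimeConstructible.powFn_unary, pow_one]

/-- **`powTwoWidthFn c x = bin 2^{succinctWidth c |x|}`** — the number of clauses of the
presented formula, in binary. [folklore] -/
noncomputable def powTwoWidthFn (c : ℕ) : List Bool → List Bool :=
  TimeConstructible.powFn 1 ∘ widthOnesFn c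

/-- Value of `powTwoWidthFn`. [folklore] -/
@[simp] theorem powTwoWidthFn_apply (c : ℕ) (x : List Bool) :
    powTwoWidthFn c x = encodeNat (2 ^ succinctWidth c x.length) := by
  simp [powTwoWidthFn, powFn_one_replicate]

/-- `powTwoWidthFn c ∈ FP`. [folklore] -/
theorem powTwoWidthFn_mem_FP (c : ℕ) : powTwoWidthFn c ∈ FP :=
  comp_mem_FP (TimeConstructible.powFn_mem_FP 1) (widthOnesFn_mem_FP c)

/-- **`powTwoPolyFn Q x = bin 2^{Q(|x|)}`** (`polyFn Q x = 1^{Q(|x|)}`, `PlumbingBricks.lean`).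
[folklore] -/
noncomputable def powTwoPolyFn (Q : Polynomial ℕ) : List Bool → List Bool :=
  TimeConstructible.powFn 1 ∘ polyFn Q

/-- Value of `powTwoPolyFn`. [folklore] -/
@[simp] theorem powTwoPolyFn_apply (Q : Polynomial ℕ) (x : List Bool) :
    powTwoPolyFn Q x = encodeNat (2 ^ Q.eval x.length) := by
  simp [powTwoPolyFn, ones, powFn_one_replicate]

/-- `powTwoPolyFn Q ∈ FP`. [folklore] -/
theorem powTwoPolyFn_mem_FP (Q : Polynomial ℕ) : powTwoPolyFn Q ∈ FP :=
  comp_mem_FP (TimeConstructible.powFn_mem_FP 1) (polyFn_mem_FP Q)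

end Literature.Computability.Complexity
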